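import Summits.Ventures.HSemireg.WeilFrameEigenblocks
import Literature.AlgebraicGeometry.HodgeTheory.WeilPlaneFibreCharts

/-!
# Venture HSemireg — the Weil vectors ARE the Weil lines: `E± = weilClassesPlus/Minus ⊆ H²ⁿ(A(ℂ); ℂ)` read in `ΛH¹` land in
# the top lines of the eigenblocks; THEOREM R on the real carriers for a class `f(Θ) + c₊ + c₋`, `c± ∈ E±` non-zero

HONEST FRAMING. Part of the Lean index of the computation cell `pub-hsemireg` (seat w3-mod4-1 gen 8, W3 SPECIAL FIBRES,
MOD4-OFFSPLIT §13). The tree's real carriers and the Literature layer `HodgeTheory/WeilClasses` (the Weil lines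
`E± = weilClassesPlus/Minus A φ n d`, «`⋀²ⁿ V±`»), `AbelianVarietyEndomorphismsHOne` (`dim E± = 1`, `E± ≤ ℂ·c` for any
non-zero member), `WeilPlaneFibreCharts` (`⌣ b± ∈ E±`), `WeilClassesHodgeType` (`⌣` of an independent family is non-zero) and
`AbelianVarietyCohomologyExteriorH1` (the comparison `⋀ᵈ H¹ ≃ Hᵈ`, `∧ ↦ ⌣`) ONLY: no semiregularity map is constructed; nothing
here says that HC / HC_CM / HC_AV holds; nothing here is a claim about any explicit variety; the polarisation 2-vector `Θ` stays
BY VALUE; no Literature fact is declared.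

WHAT IS PROVED. The last by-value input of the Weil part in `contractionRank_weilType_of_sq_eq_neg` was
«`w₊`, `w₋` non-zero members of the top lines of `V₊`, `V₋`» in `ΛH¹`. The tree's own Weil classes live in `H²ⁿ(A(ℂ); ℂ)`:
`E₊ = weilClassesPlus A φ n d`, `E₋ = weilClassesMinus A φ n d` (van Geemen's `⋀²ⁿ_K H¹ ⊗ ℂ = ⋀²ⁿ W ⊕ ⋀²ⁿ W^*`). Reading a class of
`H²ⁿ` in `ΛH¹` exactly as `totalExteriorClass` does (`(⋀²ⁿ).subtype ∘ (equiv A 2n)⁻¹`, the inverse of `∧ ↦ ⌣`):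
**`exteriorOf_mem_topLine_of_mem_weilClassesPlus/Minus`** — for `A` of dimension `2n`, `φ ≫ φ = -(d • 𝟙 A)`, `d ≥ 1`, every
`c ∈ E±` reads in the top line of `V±` (and non-zero stays non-zero): `E₊ = ℂ·(⌣ b₊)` for a basis `b₊` of `V₊`
(`cupPowOne_mem_weilClassesPlus`, `cupPowOne_ne_zero_of_linearIndependent`, `weilClassesPlus_le_span_singleton`), and
`(equiv)⁻¹(⌣ b₊) = ∧ b₊ ∈ image of ⋀²ⁿ V₊` (`equiv_ιMulti`, `ιMulti_mem_blockPow`). Hence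
**`contractionRank_weilType_of_weilClasses`** — THEOREM R on the real carriers for an abelian `2n`-fold (`n ≥ 3`) with
`φ ≫ φ = -(d • 𝟙 A)` of balanced type `p_{i√d} = n`, a polarisation 2-vector `Θ` in the span of the Weil generating set of
`(H^{0,1}; V₊, V₋)`, non-degenerate on `(H^{0,1})^⊥`, and total class `Σ_{m ≤ 2n} (q_m/m!) Θ^m + ĉ₊ + ĉ₋` where `ĉ±` are NON-ZERO
WEIL CLASSES `c± ∈ E±` read in `ΛH¹`: `contractionRank A κ = 4n² + n²·rank H₂(q) - 2n`. Of the §1 dictionary only the polarisation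
2-vector remains by value. Everything PROVED, 0 sorry; NO definition is introduced.
References: [vanGeemen1994HodgeAV] 4.9, Lemma 5.2, proof of Thm. 6.12; [LangeBirkenhake1992] Lemma 1.1.17, Ex. 1.1.6 (7);
[BuchweitzFlenner2008HH] Prop. 6.4.4.
-/

noncomputable section

open CliffordAlgebra (contractLeft)
open ExteriorAlgebra (ι)
open Module CategoryTheory
open Literature.AlgebraicGeometry.Motives Literature.AlgebraicGeometry.HodgeTheory
open Literature.AlgebraicTopology.SingularHomology

namespace Summit.Ventures.HSemireg.WeilFrame

open Summit.Ventures.HSemireg.Wedge.Hankel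

/-! ### 1. Pure wedges of vectors of `P` lie in the block powers -/

section Field

variable {K : Type*} [Field K] {V : Type*} [AddCommGroup V] [Module K V]

/-- a pure wedge `v₀ ∧ ⋯ ∧ v_{k-1}` of vectors of `P` lies in the degree-`k` block power of `P` (the image of `⋀^k P` in `ΛV`).
[cite: BourbakiAlgebre1a3, Ch. III §7 no. 2] -/
theorem ιMulti_mem_blockPow (P : Submodule K V) {k : ℕ} (v : Fin k → V) (hv : ∀ i, v i ∈ P) :
    ExteriorAlgebra.ιMulti K k v ∈ (⋀[K]^k ↥P).map (ExteriorAlgebra.map P.subtype).toLinearMap := by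
  refine ⟨ExteriorAlgebra.ιMulti K k fun i => (⟨v i, hv i⟩ : ↥P), ExteriorAlgebra.ιMulti_range K k ⟨_, rfl⟩, ?_⟩
  rw [AlgHom.toLinearMap_apply, ExteriorAlgebra.map_apply_ιMulti]
  rfl

end Field

/-! ### 2. The Weil lines read in `ΛH¹` lie in the top lines of the eigenblocks -/

variable {A : AbelianVariety ℂ}

/-- reading in `ΛH¹` is injective: a non-zero class of `Hᵈ` stays non-zero. [cite: LangeBirkenhake1992, Exercise 1.1.6 (7)] -/
theorem exteriorOf_ne_zero {d' : ℕ} {c : complexBetti A.X d'} (hc : c ≠ 0) :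
    (⋀[ℂ]^d' (complexBetti A.X 1)).subtype ((abelianVarietyCohomologyExteriorH1_holds.equiv A d').symm c) ≠ 0 := by
  intro h
  apply hc
  have h' : (abelianVarietyCohomologyExteriorH1_holds.equiv A d').symm c = 0 :=
    Subtype.ext (by rw [← Submodule.subtype_apply, h]; rfl)
  simpa using h'

/-- **`E₊` read in `ΛH¹` lies in the top line of `V₊`:** for `A` of dimension `2n`, `φ ≫ φ = -(d • 𝟙 A)`, `d ≥ 1`,
`P = V₊ = ker(φ^* - i√d) ⊆ H¹(A; ℂ)`, every `c ∈ weilClassesPlus A φ n d ⊆ H²ⁿ` satisfies: `(equiv)⁻¹ c` lies in the image of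
`⋀^{dim P} P` in `ΛH¹`. [cite: vanGeemen1994HodgeAV, 4.9 and proof of Thm. 6.12] [cite: LangeBirkenhake1992, Exercise 1.1.6 (7)] -/
theorem exteriorOf_mem_topLine_of_mem_weilClassesPlus {n d : ℕ} (hdim : A.dim = n + n) (hd : 0 < d) {φ : A ⟶ A}
    (hφ : φ ≫ φ = -(d • 𝟙 A)) {P : Submodule ℂ (complexBetti A.X 1)}
    (hP : P = Module.End.eigenspace (complexBetti.map φ.hom.hom.hom 1).hom (Complex.I * (Real.sqrt d : ℂ)))
    {c : complexBetti A.X (2 * n)} (hc : c ∈ weilClassesPlus A φ n d) :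
    (⋀[ℂ]^(2 * n) (complexBetti A.X 1)).subtype ((abelianVarietyCohomologyExteriorH1_holds.equiv A (2 * n)).symm c) ∈
      (⋀[ℂ]^(finrank ℂ ↥P) ↥P).map (ExteriorAlgebra.map P.subtype).toLinearMap := by
  haveI : Module.Finite ℂ (complexBetti A.X 1) := abelianVarietyCohomologyExteriorH1_holds.finite_one A
  subst hP
  set Vp := Module.End.eigenspace (complexBetti.map φ.hom.hom.hom 1).hom (Complex.I * (Real.sqrt d : ℂ))
  have hb₁ : finrank ℂ (complexBetti A.X 1) = 2 * (2 * n) := by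
    rw [Literature.AlgebraicGeometry.Motives.AbelianVariety.finrank_complexBetti_one, hdim]; ring
  have hVp : finrank ℂ ↥Vp = 2 * n := by
    have h2 := two_mul_finrank_eigenspace_eq hd hφ
    rw [hb₁] at h2
    exact Nat.eq_of_mul_eq_mul_left (by norm_num : 0 < 2) h2
  let bP : Basis (Fin (2 * n)) ℂ ↥Vp := (Module.finBasis ℂ ↥Vp).reindex (finCongr hVp)
  let v : Fin (2 * n) → complexBetti A.X 1 := fun i => (bP i : complexBetti A.X 1)
  have hv : ∀ i, v i ∈ Vp := fun i => (bP i).2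
  have hli : LinearIndependent ℂ v := bP.linearIndependent.map' Vp.subtype (Submodule.ker_subtype _)
  have hω : cupPowOne ℂ (ComplexPoints A.X) (2 * n) v ∈ weilClassesPlus A φ n d := cupPowOne_mem_weilClassesPlus hv
  have hω0 : cupPowOne ℂ (ComplexPoints A.X) (2 * n) v ≠ 0 := cupPowOne_ne_zero_of_linearIndependent A hli
  obtain ⟨a, ha⟩ := Submodule.mem_span_singleton.mp
    (weilClassesPlus_le_span_singleton (abelianVarietyCohomologyExteriorH1_holds.hasExteriorCohomologyH1 A) hb₁ hd hφ
      hω hω0 hc)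
  have hsymm : (abelianVarietyCohomologyExteriorH1_holds.equiv A (2 * n)).symm (cupPowOne ℂ (ComplexPoints A.X) (2 * n) v) =
      exteriorPower.ιMulti ℂ (2 * n) v := by
    rw [LinearEquiv.symm_apply_eq, abelianVarietyCohomologyExteriorH1.equiv_ιMulti]
  rw [← ha, map_smul, hsymm, map_smul, Submodule.subtype_apply, exteriorPower.ιMulti_apply_coe, hVp]
  exact Submodule.smul_mem _ a (ιMulti_mem_blockPow Vp v hv)

/-- **`E₋` read in `ΛH¹` lies in the top line of `V₋`**, `Q = V₋ = ker(φ^* + i√d)`.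
[cite: vanGeemen1994HodgeAV, 4.9 and proof of Thm. 6.12] -/
theorem exteriorOf_mem_topLine_of_mem_weilClassesMinus {n d : ℕ} (hdim : A.dim = n + n) (hd : 0 < d) {φ : A ⟶ A}
    (hφ : φ ≫ φ = -(d • 𝟙 A)) {Q : Submodule ℂ (complexBetti A.X 1)}
    (hQ : Q = Module.End.eigenspace (complexBetti.map φ.hom.hom.hom 1).hom (-(Complex.I * (Real.sqrt d : ℂ))))
    {c : complexBetti A.X (2 * n)} (hc : c ∈ weilClassesMinus A φ n d) :
    (⋀[ℂ]^(2 * n) (complexBetti A.X 1)).subtype ((abelianVarietyCohomologyExteriorH1_holds.equiv A (2 * n)).symm c) ∈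
      (⋀[ℂ]^(finrank ℂ ↥Q) ↥Q).map (ExteriorAlgebra.map Q.subtype).toLinearMap := by
  haveI : Module.Finite ℂ (complexBetti A.X 1) := abelianVarietyCohomologyExteriorH1_holds.finite_one A
  subst hQ
  set Vm := Module.End.eigenspace (complexBetti.map φ.hom.hom.hom 1).hom (-(Complex.I * (Real.sqrt d : ℂ)))
  have hb₁ : finrank ℂ (complexBetti A.X 1) = 2 * (2 * n) := by
    rw [Literature.AlgebraicGeometry.Motives.AbelianVariety.finrank_complexBetti_one, hdim]; ring
  have hVm : finrank ℂ ↥Vm = 2 * n := by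
    have h2 := two_mul_finrank_eigenspace_eq hd hφ
    rw [hb₁, finrank_eigenspace_eq_finrank_eigenspace_neg hd hφ] at h2
    exact Nat.eq_of_mul_eq_mul_left (by norm_num : 0 < 2) h2
  let bM : Basis (Fin (2 * n)) ℂ ↥Vm := (Module.finBasis ℂ ↥Vm).reindex (finCongr hVm)
  let v : Fin (2 * n) → complexBetti A.X 1 := fun i => (bM i : complexBetti A.X 1)
  have hv : ∀ i, v i ∈ Vm := fun i => (bM i).2
  have hli : LinearIndependent ℂ v := bM.linearIndependent.map' Vm.subtype (Submodule.ker_subtype _)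
  have hω : cupPowOne ℂ (ComplexPoints A.X) (2 * n) v ∈ weilClassesMinus A φ n d := cupPowOne_mem_weilClassesMinus hv
  have hω0 : cupPowOne ℂ (ComplexPoints A.X) (2 * n) v ≠ 0 := cupPowOne_ne_zero_of_linearIndependent A hli
  obtain ⟨a, ha⟩ := Submodule.mem_span_singleton.mp
    (weilClassesMinus_le_span_singleton (abelianVarietyCohomologyExteriorH1_holds.hasExteriorCohomologyH1 A) hb₁ hd hφ
      hω hω0 hc)
  have hsymm : (abelianVarietyCohomologyExteriorH1_holds.equiv A (2 * n)).symm (cupPowOne ℂ (ComplexPoints A.X) (2 * n) v) =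
      exteriorPower.ιMulti ℂ (2 * n) v := by
    rw [LinearEquiv.symm_apply_eq, abelianVarietyCohomologyExteriorH1.equiv_ιMulti]
  rw [← ha, map_smul, hsymm, map_smul, Submodule.subtype_apply, exteriorPower.ιMulti_apply_coe, hVm]
  exact Submodule.smul_mem _ a (ιMulti_mem_blockPow Vm v hv)

/-! ### 3. THEOREM R on the real carriers for a class `f(Θ) + c₊ + c₋` with non-zero Weil classes `c± ∈ E±` -/

/-- **THEOREM R on the real carriers — Weil type `(n, n)`, the Weil part given by the tree's WEIL CLASSES** (`n ≥ 3`):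
`A` a complex abelian variety of dimension `2n`; `φ : A ⟶ A` with `φ ≫ φ = -(d • 𝟙 A)`, `d ≥ 1`; `P = V₊ = ker(φ^* - i√d)`,
`Q = V₋ = ker(φ^* + i√d)`; balanced type `p_{i√d} = dim (P ∩ H^{1,0}) = n`; a 2-vector `Θ` in the span of the Weil generating set of
`(H^{0,1}; P, Q)`, non-degenerate on `(H^{0,1})^⊥` («the `K`-compatible polarisation», by value); non-zero Weil classes
`c₊ ∈ E₊ = weilClassesPlus A φ n d`, `c₋ ∈ E₋ = weilClassesMinus A φ n d` in `H²ⁿ(A(ℂ); ℂ)`; and the total class of `κ` equal, in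
`ΛH¹`, to `Σ_{m ≤ 2n} (q_m/m!) Θ^m + ĉ₊ + ĉ₋` (`ĉ± = (equiv)⁻¹ c±`, read exactly as `totalExteriorClass` reads `κ`). Then
`contractionRank A κ = 4n² + n²·rank H₂(q) - 2n = (4 + ρ)n² - 2n`.
[cite: vanGeemen1994HodgeAV, 4.9 and Lemma 5.2] [cite: BuchweitzFlenner2008HH, Prop. 6.4.4] [cite: MumfordAV1970, §1 (4) and §4 (iii)] -/
theorem contractionRank_weilType_of_weilClasses (hA : IsSmoothProjective A.dim A.X)
    (κ : ∀ p : ℕ, complexBetti A.X (2 * p)) {n d : ℕ} (hn : 3 ≤ n) (hdim : A.dim = n + n) (hd : 0 < d) {φ : A ⟶ A}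
    (hφ : φ ≫ φ = -(d • 𝟙 A)) {P Q : Submodule ℂ (complexBetti A.X 1)}
    (hP : P = Module.End.eigenspace (complexBetti.map φ.hom.hom.hom 1).hom (Complex.I * (Real.sqrt d : ℂ)))
    (hQ : Q = Module.End.eigenspace (complexBetti.map φ.hom.hom.hom 1).hom (-(Complex.I * (Real.sqrt d : ℂ))))
    (hp : finrank ℂ ↥(P ⊓ hodgeOneZero hA) = n) {Θ : ExteriorAlgebra ℂ (complexBetti A.X 1)}
    (hΘ : Θ ∈ Submodule.span ℂ {z : ExteriorAlgebra ℂ (complexBetti A.X 1) | ∃ x l : complexBetti A.X 1,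
      ((x ∈ P ∧ l ∈ hodgeZeroOne hA ⊓ Q) ∨ (x ∈ Q ∧ l ∈ hodgeZeroOne hA ⊓ P)) ∧ z = ι ℂ x * ι ℂ l})
    (hnd : ∀ l ∈ (hodgeZeroOne hA : Set (complexBetti A.X 1)), ι ℂ l ∈ Submodule.span ℂ
      {y : ExteriorAlgebra ℂ (complexBetti A.X 1) |
        ∃ ψ ∈ {θ : Module.Dual ℂ (complexBetti A.X 1) | ∀ v ∈ hodgeZeroOne hA, θ v = 0}, y = contractLeft ψ Θ})
    {cP cQ : complexBetti A.X (2 * n)} (hcP : cP ∈ weilClassesPlus A φ n d) (hcP0 : cP ≠ 0)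
    (hcQ : cQ ∈ weilClassesMinus A φ n d) (hcQ0 : cQ ≠ 0) (q : ℕ → ℂ)
    (hx : totalExteriorClass A κ = (∑ m ∈ Finset.range (n + n + 1), (q m * ((m.factorial : ℕ) : ℂ)⁻¹) • Θ ^ m) +
      (⋀[ℂ]^(2 * n) (complexBetti A.X 1)).subtype ((abelianVarietyCohomologyExteriorH1_holds.equiv A (2 * n)).symm cP) +
      (⋀[ℂ]^(2 * n) (complexBetti A.X 1)).subtype ((abelianVarietyCohomologyExteriorH1_holds.equiv A (2 * n)).symm cQ)) :
    contractionRank A κ = ((4 * (n * n) + n * n * (hankel1 ℂ (n + n) 2 q).rank - 2 * n : ℕ) : Cardinal) :=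
  contractionRank_weilType_of_sq_eq_neg hA κ hn hdim hd hφ hP hQ hp hΘ hnd
    (exteriorOf_mem_topLine_of_mem_weilClassesPlus hdim hd hφ hP hcP) (exteriorOf_ne_zero hcP0)
    (exteriorOf_mem_topLine_of_mem_weilClassesMinus hdim hd hφ hQ hcQ) (exteriorOf_ne_zero hcQ0) q hx

end Summit.Ventures.HSemireg.WeilFrame

end
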